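import Mathlib
import Literature.Probability.Process.RootedHardCoreConfig
import Summits.AtomisticToContinuum.Crystallization.Theorems.ChartedPlanarOrderBarlowGluingFrame
import Summits.AtomisticToContinuum.Crystallization.Theorems.ChartedPlanarOrderBarlowGluingCharts
import Summits.AtomisticToContinuum.Crystallization.Theorems.GappedShellCensusCleanLimitsHaveWindowsCleanChartGrowth
import Summits.AtomisticToContinuum.Crystallization.Theorems.GappedShellCensusCleanLimitsHaveWindowsCleanChartTGlobalG
import Summits.AtomisticToContinuum.Crystallization.Theorems.ReggeStarCoercivityDefectFreeCrystallizesFunnelChart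
import Summits.AtomisticToContinuum.Crystallization.Theorems.OverbindingBudgetTwoShellShape
import Summits.AtomisticToContinuum.Crystallization.Theorems.OverbindingBudgetElasticSplitDoorBridge

/-!
# Barlow gluing at tolerance `1/16` — part III: connectivity, cubic growth, `BarlowGluingW`

Route `OverbindingBudget` (stmt-AtomisticToContinuum-31280), cell `decomp-a2c`, lens 3.  Part I
(`…ChartedPlanarOrderBarlowGluingFrame`) reduced `IsCharted (μS Y)` to a chart bundle on a connected window graph with
cubic growth; part II (`…ChartedPlanarOrderBarlowGluingCharts`) put an integer chart at every site of an all-good set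
`Y`.  Here:

* `charts` — choice over sites + `CleanHull.transfer_of_close` at the common scale `193/200`: the
  chart/transfer bundle of `Clean.transportSystem_of_connected`, and a bonded neighbour in every direction
  (cosine `≥ 139/250`, the hypothesis of `CleanHull.clean_exists_step`);
* `exists_walk`, `connected` — greedy walks (a step towards a target at distance `≥ 27/20` gains `1/12`;
  targets within `27/20 ≤ 3a/2` are reached in two steps, `two_step`), so the window graph is connected;
* `cube_le_ncard`, `cubicGrowth`, `growth` — covering radius `< 6/5` (`CleanHull.clean_exists_near`) and
  uniform discreteness give `(n/15)³ ≤ #Ball_n(x)` for `n ≥ 12`;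
* `isCharted_μS`, **`barlowGluingW_holds : BarlowGluingW`** — through the frame
  `ChartedPlanarOrderBarlowGluingFrame.isCharted_μS_of_chartBundle` (`Clean.transportSystem_of_connected` +
  `PalmGoodLaw.FunnelChart.barlowChart_of_transportSystem`, the 9227 growth descent with an existential cubic constant).

Slot 5 of the cut of record (cone XL, `OverbindingBudgetGrossMargin.rdef_fortieth_of_recordK_gross_ref`,
hypothesis `hB₂ : BarlowGluingW`) is thereby a theorem; the re-cut cone is in
`…ChartedPlanarOrderBarlowGluingCone`.
-/

noncomputable section

namespace Summit.AtomisticToContinuum.Crystallization.Theorems.ChartedPlanarOrderBarlowGluing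

open Literature.Geometry.DiscreteGeometry
open Literature.MathematicalPhysics.StatisticalMechanics (UniformlyDiscrete)
open Summit.AtomisticToContinuum.Crystallization.Theorems.PalmUnimodularRigidityShellsToBarlowChart
open Summit.AtomisticToContinuum.Crystallization.Theorems.OverbindingBudgetTwoShellShape (BarlowGluingW)
open Summit.AtomisticToContinuum.Crystallization.Theorems.ChartedPlanarOrderRigidityDoor (IsCharted)
open Summit.AtomisticToContinuum.Crystallization.Theorems.ChartedPlanarOrderDensityDichotomy (μS)
open Summit.AtomisticToContinuum.Crystallization.Theorems.ChartedPlanarOrderBarlowGluingFrame (isCharted_μS_of_chartBundle)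
open Summit.AtomisticToContinuum.Crystallization.Theorems.ChartedPlanarOrderBarlowGluingCharts (intChart two_step)
open MeasureTheory Metric
open scoped ENNReal NNReal

local notation "E3" => EuclideanSpace ℝ (Fin 3)

/-! ## §1 Charts with transfer, and the direction clause -/

/-- **Charts of an all-good set.**  If every point of `Y` is `(1/16, 9/10, 103/100)`-two-shell-good, then
`Y` carries integer charts `(Pc, nb)` — pattern `fcc3Int`/`hcpInt`, labelling bijective onto the
`(0, 28/25]`-bonded neighbours, exact links — with label TRANSFER across bonds (the hypothesis `hch` of
`Clean.transportSystem_of_connected`), and every site has a bonded neighbour in every direction at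
cosine `≥ 139/250` (the hypothesis `hdir` of `CleanHull.clean_exists_step`). [cite: HalesDSP2012, §1.3] -/
theorem charts {Y : Set E3} (hY : ∀ q ∈ Y, IsTwoShellGoodSet (1 / 16) (9 / 10) (103 / 100) Y q) :
    ∃ (Pc : E3 → Finset (Fin 3 → ℤ)) (nb : E3 → (Fin 3 → ℤ) → E3),
      ((∀ z ∈ Y, (Pc z = fcc3Int ∨ Pc z = hcpInt) ∧
          Set.BijOn (nb z) (↑(Pc z) : Set (Fin 3 → ℤ)) {y | y ∈ Y ∧ (0 < dist z y ∧ dist z y ≤ 28 / 25)} ∧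
          (∀ t ∈ Pc z, ∀ t' ∈ Pc z, ((0 < dist (nb z t) (nb z t') ∧ dist (nb z t) (nb z t') ≤ 28 / 25) ↔
            sqNormInt (t - t') = 18))) ∧
        (∀ x ∈ Y, ∀ y ∈ Y, (0 < dist x y ∧ dist x y ≤ 28 / 25) →
          ∀ t ∈ Pc x, ∀ t' ∈ Pc x, ∀ u ∈ Pc y, ∀ u' ∈ Pc y,
            nb y u = nb x t → nb y u' = nb x t' → sqNormInt (u - u') = sqNormInt (t - t'))) ∧
      (∀ x ∈ Y, ∀ d : E3, ∃ y ∈ Y, y ≠ x ∧ dist x y ≤ 28 / 25 ∧ 139 / 250 * ‖d‖ ≤ inner ℝ (y - x) d) := by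
  classical
  choose! L nb hL hbij hA hlink hdir using fun x (hx : x ∈ Y) => intChart hY hx
  refine ⟨L, nb, ⟨fun z hz => ⟨hL z hz, hbij z hz, hlink z hz⟩, ?_⟩, ?_⟩
  · intro x hx y hy hxy t ht t' ht' u hu u' hu' hut hut'
    obtain ⟨A, hclx⟩ := hA x hx
    obtain ⟨A', hcly⟩ := hA y hy
    exact CleanHull.transfer_of_close (by norm_num) hx hy hxy (hL x hx) (hbij x hx) hclx (hlink x hx) (hL y hy)
      (hbij y hy) hcly (hlink y hy) ht ht' hu hu' hut hut'
  · intro x hx d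
    obtain ⟨t, ht, h⟩ := hdir x hx d
    have hm := (hbij x hx).mapsTo (Finset.mem_coe.2 ht)
    refine ⟨nb x t, hm.1, fun h' => ?_, hm.2.2, h⟩
    have := hm.2.1
    rw [h', dist_self] at this
    exact lt_irrefl _ this

/-- Targets within `27/20` are two steps away in the window graph. [cite: HalesDSP2012, §1.3] -/
theorem loc_walk {Y : Set E3} (hY : ∀ q ∈ Y, IsTwoShellGoodSet (1 / 16) (9 / 10) (103 / 100) Y q) :
    ∀ x ∈ Y, ∀ z ∈ Y, dist x z ≤ 27 / 20 → ∃ w : (windowGraph Y).Walk x z, w.length ≤ 2 := by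
  intro x hx z hz hd
  by_cases hxz : x = z
  · subst hxz
    exact ⟨SimpleGraph.Walk.nil, by simp⟩
  rcases two_step hY hx hz hxz hd with ⟨-, hle⟩ | ⟨y, hy, ⟨h1, h1'⟩, ⟨h2, h2'⟩⟩
  · exact ⟨SimpleGraph.Walk.cons (CleanHull.clean_adj_of_dist_le hx hz hxz hle) SimpleGraph.Walk.nil, by simp⟩
  · have hxy : x ≠ y := fun h => by rw [h, dist_self] at h1; exact lt_irrefl _ h1
    have hyz : y ≠ z := fun h => by rw [h, dist_self] at h2; exact lt_irrefl _ h2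
    exact ⟨SimpleGraph.Walk.cons (CleanHull.clean_adj_of_dist_le hx hy hxy h1')
      (SimpleGraph.Walk.cons (CleanHull.clean_adj_of_dist_le hy hz hyz h2') SimpleGraph.Walk.nil), by simp⟩

/-! ## §2 Greedy walks: connectivity -/

section Growth

variable {S : Set E3}

/-- At distance `≥ 27/20` from the target a greedy step gains `1/12`. [folklore] -/
theorem step_far {r : ℝ} (hr : 27 / 20 ≤ r) : r ^ 2 - 278 / 250 * r + 784 / 625 ≤ (r - 1 / 12) ^ 2 := by
  nlinarith

/-- **Greedy walks.** If targets within `27/20` are two steps away and every site has a bonded neighbour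
in every direction (cosine `≥ 139/250`), then every `x ∈ S` with `dist (x, z) ≤ 27/20 + m/12`, `z ∈ S`,
is joined to `z` by a walk of length `≤ m + 2`. [folklore] -/
theorem exists_walk
    (hloc : ∀ x ∈ S, ∀ z ∈ S, dist x z ≤ 27 / 20 → ∃ w : (windowGraph S).Walk x z, w.length ≤ 2)
    (hdir : ∀ x ∈ S, ∀ d : E3, ∃ y ∈ S, y ≠ x ∧ dist x y ≤ 28 / 25 ∧ 139 / 250 * ‖d‖ ≤ inner ℝ (y - x) d)
    {z : E3} (hz : z ∈ S) :
    ∀ m : ℕ, ∀ x ∈ S, dist x z ≤ 27 / 20 + (m : ℝ) / 12 →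
      ∃ w : (windowGraph S).Walk x z, w.length ≤ m + 2 := by
  intro m
  induction m with
  | zero =>
    intro x hx hd
    obtain ⟨w, hw⟩ := hloc x hx z hz (by simpa using hd)
    exact ⟨w, by omega⟩
  | succ m ih =>
    intro x hx hd
    by_cases hle : dist x z ≤ 27 / 20 + (m : ℝ) / 12
    · obtain ⟨w, hw⟩ := ih x hx hle
      exact ⟨w, by omega⟩
    have hlt := not_le.1 hle
    obtain ⟨y, hy, hadj, hest⟩ := CleanHull.clean_exists_step hdir hx z
    have h32 : 27 / 20 ≤ dist x z := by
      have : (0 : ℝ) ≤ (m : ℝ) / 12 := by positivity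
      linarith
    have h2 : dist y z ^ 2 ≤ (dist x z - 1 / 12) ^ 2 := hest.trans (step_far h32)
    have hyz : dist y z ≤ dist x z - 1 / 12 := (abs_le_of_sq_le_sq' h2 (by linarith)).2
    have hyz' : dist y z ≤ 27 / 20 + (m : ℝ) / 12 := by
      push_cast at hd
      linarith
    obtain ⟨w, hw⟩ := ih y hy hyz'
    exact ⟨SimpleGraph.Walk.cons hadj w, by rw [SimpleGraph.Walk.length_cons]; omega⟩

/-- **The window graph is connected.** [folklore] -/
theorem connected
    (hloc : ∀ x ∈ S, ∀ z ∈ S, dist x z ≤ 27 / 20 → ∃ w : (windowGraph S).Walk x z, w.length ≤ 2)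
    (hdir : ∀ x ∈ S, ∀ d : E3, ∃ y ∈ S, y ≠ x ∧ dist x y ≤ 28 / 25 ∧ 139 / 250 * ‖d‖ ≤ inner ℝ (y - x) d) :
    ∀ x ∈ S, ∀ y ∈ S, Nonempty ((windowGraph S).Walk x y) := by
  intro x hx y hy
  have hm : dist x y ≤ 27 / 20 + ((⌈12 * dist x y⌉₊ : ℕ) : ℝ) / 12 := by
    have h1 : 12 * dist x y ≤ ((⌈12 * dist x y⌉₊ : ℕ) : ℝ) := Nat.le_ceil _
    linarith [dist_nonneg (x := x) (y := y)]
  obtain ⟨w, -⟩ := exists_walk hloc hdir hy ⌈12 * dist x y⌉₊ x hx hm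
  exact ⟨w⟩

/-! ## §3 Cubic growth -/

/-- **Bounded parts of a uniformly discrete set are finite.** [folklore] -/
theorem finite_inter_closedBall (hud : UniformlyDiscrete S) (x : E3) (R : ℝ) : (S ∩ closedBall x R).Finite := by
  obtain ⟨δ, hδ, hsep⟩ := hud
  rw [Set.inter_comm]
  exact Literature.Probability.Process.LocalConfig.finite_inter_of_separated hδ hsep (isCompact_closedBall x R)

/-- **Volume count.** For `x ∈ S` and `R ≥ 6/5`, the set `S ∩ B(x, R)` has at least `((R − 6/5)/(6/5))³`
points (covering radius `< 6/5`, `CleanHull.clean_exists_near`). [folklore] -/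
theorem cube_le_ncard (hud : UniformlyDiscrete S)
    (hdir : ∀ x ∈ S, ∀ d : E3, ∃ y ∈ S, y ≠ x ∧ dist x y ≤ 28 / 25 ∧ 139 / 250 * ‖d‖ ≤ inner ℝ (y - x) d)
    {x : E3} (hx : x ∈ S) {R : ℝ} (hR : 6 / 5 ≤ R) :
    ((R - 6 / 5) / (6 / 5)) ^ 3 ≤ (Set.ncard (S ∩ closedBall x R) : ℝ) := by
  have hF := finite_inter_closedBall hud x R
  have hcov : closedBall x (R - 6 / 5) ⊆ ⋃ y ∈ hF.toFinset, closedBall y (6 / 5) := by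
    intro p hp
    obtain ⟨y, hy, hyp⟩ := CleanHull.clean_exists_near hdir hx p
    have hyF : y ∈ hF.toFinset := by
      rw [Set.Finite.mem_toFinset]
      refine ⟨hy, mem_closedBall.2 ?_⟩
      have := mem_closedBall.1 hp
      linarith [dist_triangle y p x]
    exact Set.mem_biUnion hyF (mem_closedBall'.2 hyp.le)
  have hvol : volume (closedBall x (R - 6 / 5)) ≤
      ∑ y ∈ hF.toFinset, volume (closedBall y (6 / 5 : ℝ)) :=
    (measure_mono hcov).trans (measure_biUnion_finset_le _ _)
  rw [Measure.addHaar_closedBall volume x (by linarith : (0 : ℝ) ≤ R - 6 / 5),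
    Finset.sum_congr rfl (fun y _ =>
      Measure.addHaar_closedBall volume y (by norm_num : (0 : ℝ) ≤ 6 / 5)),
    Finset.sum_const, nsmul_eq_mul, finrank_euclideanSpace_fin, ← mul_assoc] at hvol
  have hV0 : volume (ball (0 : E3) 1) ≠ 0 := (measure_ball_pos volume (0 : E3) one_pos).ne'
  have hVt : volume (ball (0 : E3) 1) ≠ ⊤ := measure_ball_lt_top.ne
  rw [ENNReal.mul_le_mul_iff_left hV0 hVt, ← ENNReal.ofReal_natCast,
    ← ENNReal.ofReal_mul (by positivity), ENNReal.ofReal_le_ofReal_iff (by positivity)] at hvol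
  rw [Set.ncard_eq_toFinset_card _ hF, div_pow, div_le_iff₀ (by positivity)]
  exact hvol

/-- **Cubic growth of the window graph**: the ball of radius `n ≥ 12` about `x ∈ S` in the window graph
has at least `(n/15)³` points. [folklore] -/
theorem cubicGrowth (hud : UniformlyDiscrete S)
    (hloc : ∀ x ∈ S, ∀ z ∈ S, dist x z ≤ 27 / 20 → ∃ w : (windowGraph S).Walk x z, w.length ≤ 2)
    (hdir : ∀ x ∈ S, ∀ d : E3, ∃ y ∈ S, y ≠ x ∧ dist x y ≤ 28 / 25 ∧ 139 / 250 * ‖d‖ ≤ inner ℝ (y - x) d)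
    {x : E3} (hx : x ∈ S) {n : ℕ} (hn : 12 ≤ n) :
    ((n : ℝ) / 15) ^ 3 ≤ (Set.ncard (windowBall S x n) : ℝ) := by
  have hsub : S ∩ closedBall x (27 / 20 + ((n - 2 : ℕ) : ℝ) / 12) ⊆ windowBall S x n := by
    rintro y ⟨hy, hyR⟩
    rw [mem_closedBall, dist_comm] at hyR
    obtain ⟨w, hw⟩ := exists_walk hloc hdir hy (n - 2) x hx hyR
    exact ⟨w, by omega⟩
  have hWfin : (windowBall S x n).Finite := by
    refine (finite_inter_closedBall hud x (28 / 25 * n)).subset ?_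
    rintro y ⟨w, hw⟩
    obtain ⟨hyS, hd⟩ := walk_mem_and_dist w hx
    refine ⟨hyS, mem_closedBall.2 ?_⟩
    rw [dist_comm]
    have : (w.length : ℝ) ≤ n := by exact_mod_cast hw
    linarith
  have hR : (6 : ℝ) / 5 ≤ 27 / 20 + ((n - 2 : ℕ) : ℝ) / 12 := by
    have : (0 : ℝ) ≤ ((n - 2 : ℕ) : ℝ) / 12 := by positivity
    linarith
  have hcount := cube_le_ncard hud hdir hx hR
  have hmono : (Set.ncard (S ∩ closedBall x (27 / 20 + ((n - 2 : ℕ) : ℝ) / 12)) : ℝ) ≤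
      Set.ncard (windowBall S x n) := by
    exact_mod_cast Set.ncard_le_ncard hsub hWfin
  refine le_trans ?_ (hcount.trans hmono)
  have hn0 : (12 : ℝ) ≤ n := by exact_mod_cast hn
  rw [Nat.cast_sub (by omega : 2 ≤ n)]
  push_cast
  have h1 : (n : ℝ) / 15 ≤ (27 / 20 + ((n : ℝ) - 2) / 12 - 6 / 5) / (6 / 5) := by linarith
  exact pow_le_pow_left₀ (by positivity) h1 3

/-- **Eventual cubic growth with an existential constant** (the hypothesis `hgrowth` of
`PalmGoodLaw.FunnelChart.barlowChart_of_transportSystem`). [folklore] -/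
theorem growth (hud : UniformlyDiscrete S)
    (hloc : ∀ x ∈ S, ∀ z ∈ S, dist x z ≤ 27 / 20 → ∃ w : (windowGraph S).Walk x z, w.length ≤ 2)
    (hdir : ∀ x ∈ S, ∀ d : E3, ∃ y ∈ S, y ≠ x ∧ dist x y ≤ 28 / 25 ∧ 139 / 250 * ‖d‖ ≤ inner ℝ (y - x) d) :
    ∀ x ∈ S, ∃ C : ℝ, 0 < C ∧ ∃ n₀ : ℕ, ∀ n : ℕ, n₀ ≤ n →
      C * (n : ℝ) ^ 3 ≤ (Set.ncard (windowBall S x n) : ℝ) := by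
  intro x hx
  refine ⟨1 / 3375, by norm_num, 12, fun n hn => ?_⟩
  have e : (1 : ℝ) / 3375 * (n : ℝ) ^ 3 = ((n : ℝ) / 15) ^ 3 := by ring
  rw [e]
  exact cubicGrowth hud hloc hdir hx hn

end Growth

/-! ## §4 Assembly -/

/-- **An all-good uniformly discrete set containing `0` is Barlow-charted**: its `(0, 28/25]`-bond graph
is isomorphic to the contact graph of a Barlow stacking `barlowStacking 1 √(2/3) s`, `s` a Hägg word.
Charts + transfer + connectivity give a `TransportSystem` (`Clean.transportSystem_of_connected`); cubic
growth feeds the 9227 growth descent (`PalmGoodLaw.FunnelChart.barlowChart_of_transportSystem`).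
[cite: HalesDSP2012, §1.3; ConwaySloane1999, Ch. 4 §6.3] -/
theorem isCharted_μS {Y : Set E3} (h0 : (0 : E3) ∈ Y) (hud : UniformlyDiscrete Y)
    (hY : ∀ q ∈ Y, IsTwoShellGoodSet (1 / 16) (9 / 10) (103 / 100) Y q) : IsCharted (μS Y) := by
  obtain ⟨Pc, nb, hch, hdir⟩ := charts hY
  have hloc := loc_walk hY
  exact isCharted_μS_of_chartBundle h0 hch (connected hloc hdir) (growth hud hloc hdir)

/-- **Slot 5 of the `OverbindingBudget` cone holds: `BarlowGluingW`.** [this development] -/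
theorem barlowGluingW_holds : BarlowGluingW := fun _ h0 hud hY => isCharted_μS h0 hud hY

end Summit.AtomisticToContinuum.Crystallization.Theorems.ChartedPlanarOrderBarlowGluing
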